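import Summits.AtomisticToContinuum.BoseEinsteinCondensation.Theses.BECInsertionCorrector
import Summits.AtomisticToContinuum.BoseEinsteinCondensation.Theses.BECSectorPoincareTwoScale
import Summits.AtomisticToContinuum.BoseEinsteinCondensation.Theorems.BECInsertionCorrectorCorrectorClosureFactorisationExact
import Summits.AtomisticToContinuum.BoseEinsteinCondensation.Theorems.BECInsertionCorrectorCorrectorClosureSplit
import Summits.AtomisticToContinuum.BoseEinsteinCondensation.Theorems.BECSectorPoincareTwoScaleLandauToPeriodicBEC
import HarnessLib

/-!
# Strategy census s10 (independent, family `-s`) — typed attempts for crux `CorrectorClosure`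
# (stmt-AtomisticToContinuum-12058, route `BECInsertionCorrector`)

Companion of `Cruxes/CorrectorClosure/STRATEGY-CENSUS-s10.md`. Every declaration here is either a
definition naming an object of the census or a short composition of LANDED theorems; no `sorry`.

* §1 (inventory (i), "from the summit down"): the weakest replacement of the crux that keeps the route's
  deciding theorem `closes` provable is `WeakClosure := K1 → ∀ v, PeriodicBEC-body v`
  (`summit_of_weakClosure`), and the crux implies it (`weakClosure_of_correctorClosure`, p121285); so
  the floor of every strategy is torus BEC at thermodynamic scale under the density-response bound K1.
* §2 (Strengthen): the more rigid hypothesis `S⁺ := EnergyConvexityWindow ∧ LandauSectorBound`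
  (items 9094 ∧ 9091 of route `BECSectorPoincareTwoScale`) gives the torus-BEC half for every bounded
  admissible `v` by LANDED theorems with K1 idle (`periodicBECBody_bounded_of_strengthen`); and K1 is a
  CONSEQUENCE of a sector floor (`…SectorFloorToHMinusOne`, m₋₁ ≤ m₁/ω²), never a cause.
* §3 (Decomposition): the kernel-checked split `CC ↔ (∀ v, PeriodicBEC-body v) ∧ InsertionResidueOfBEC`
  given K1 (`correctorClosure_iff_of_staticResponseBound`, p169803) — re-exported by name; the hard piece
  is `∀ v, PeriodicBEC-body v` = item 8997.
* §4 (Transfer): the transferable half of the reflection-positivity siblings (KLS 1988 / ALSSY 2004) is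
  "one-body infrared bound ⇒ condensation", landed as `periodicBEC_of_irBoundFor`; the non-transferring
  step is the infrared bound itself (item 3972 / 12620), in which K1 does not occur.
* §5 (Negation): `¬CC ↔ K1 ∧ ¬IR`; a counterexample must PROVE K1 for every admissible `v` and exhibit a
  `v` whose torus near-minimisers fail the residue floor; `not_correctorClosure_of_nonCondensing` records
  that a single admissible non-condensing `v` ("Bose metal") together with K1 refutes the crux.
-/

namespace Summit.AtomisticToContinuum.BoseEinsteinCondensation.Cruxes.CorrectorClosure.CensusS10

open Literature.MathematicalPhysics.QuantumManyBody.BoseGas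
open Summit.AtomisticToContinuum.BoseEinsteinCondensation.Theses.BECInsertionCorrector
open Summit.AtomisticToContinuum.BoseEinsteinCondensation.Theses.BECSectorPoincareTwoScale
  (LandauSectorBound EnergyConvexityWindow)
open Summit.AtomisticToContinuum.BoseEinsteinCondensation.Theorems.PeriodicIRBound.Negative (IRBoundFor)
open scoped ENNReal

/-! ## §0 Vocabulary -/

/-- The torus-BEC body for ONE potential: verbatim the signature of item stmt-AtomisticToContinuum-8997
(`PeriodicBEC`) at `v`, i.e. the hypothesis `BoundaryTransferWeak` consumes. [folklore] -/
def PeriodicBECBody (v : ℝ → ℝ≥0∞) : Prop :=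
  ∃ ρ₀ : ℝ, 0 < ρ₀ ∧ ∀ ρ : ℝ, 0 < ρ → ρ < ρ₀ → ∃ c : ℝ, 0 < c ∧ ∀ᶠ N : ℕ in Filter.atTop,
    ∃ δ : ℝ≥0∞, 0 < δ ∧ ∀ Ψ : PeriodicTrialState N (sideLength ρ N),
      periodicEnergy v Ψ ≤ periodicGroundStateEnergy v N (sideLength ρ N) + δ →
      ENNReal.ofReal (c * N) ≤ condensateOccupation N (sideLength ρ N) Ψ.ψ

/-- The insertion-residue body for ONE potential: verbatim the body of `InsertionResidue` at `v`. [folklore] -/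
def InsertionResidueBody (v : ℝ → ℝ≥0∞) : Prop :=
  ∃ ρ₀ : ℝ, 0 < ρ₀ ∧ ∀ ρ : ℝ, 0 < ρ → ρ < ρ₀ → ∃ c : ℝ, 0 < c ∧ ∀ᶠ N : ℕ in Filter.atTop,
    ∃ δ : ℝ≥0∞, 0 < δ ∧ ∃ Θ : PeriodicTrialState N (sideLength ρ (N + 1)),
      periodicEnergy v Θ ≤ periodicGroundStateEnergy v N (sideLength ρ (N + 1)) + δ ∧
      ∀ Ψ : PeriodicTrialState (N + 1) (sideLength ρ (N + 1)),
        periodicEnergy v Ψ ≤ periodicGroundStateEnergy v (N + 1) (sideLength ρ (N + 1)) + δ →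
        ENNReal.ofReal c ≤ ENNReal.ofReal ((sideLength ρ (N + 1) ^ 3)⁻¹) *
          (‖∫ X in cellN N (sideLength ρ (N + 1)), (starRingEnd ℂ) (Θ.ψ X) *
              ∫ x in cell (sideLength ρ (N + 1)), Ψ.ψ (Matrix.vecCons x X)‖₊ : ℝ≥0∞) ^ 2

/-- `InsertionResidue` is `∀ v admissible, InsertionResidueBody v` (definitional). [folklore] -/
theorem insertionResidue_iff : InsertionResidue ↔ ∀ v, IsRepulsiveFiniteRange v → InsertionResidueBody v :=
  Iff.rfl

/-! ## §1 Inventory (i): the weakest replacement of the crux, read off the summit statement -/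

/-- **W₁**, the weakest statement that can stand in the crux's place in `closes`: K1 gives torus BEC of the
near-minimisers for every admissible potential. [folklore] -/
def WeakClosure : Prop :=
  StaticResponseBound → ∀ v : ℝ → ℝ≥0∞, IsRepulsiveFiniteRange v → PeriodicBECBody v

/-- W₁ SUFFICES: with the route's other two open cruxes (K1, item 12057; `BoundaryTransferWeak`, item 0827)
it gives the sub-problem statement — `ResidueCondenses` and the fidelity content of `InsertionResidue` are
not consumed by the summit. [folklore] -/
theorem summit_of_weakClosure (h₁ : StaticResponseBound) (hW : WeakClosure) (h₄ : BoundaryTransferWeak) :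
    _root_.BoseEinsteinCondensation :=
  fun v hv => h₄ v hv (hW h₁ v hv)

/-- W₁ IS NECESSARY: the crux implies it (Cauchy–Schwarz, `ResidueCondenses_proof`; kernel necessity of
torus BEC inside any proof of the crux, p121285). [folklore] -/
theorem weakClosure_of_correctorClosure (hCC : CorrectorClosure) : WeakClosure :=
  fun hK1 => Theorems.CorrectorClosure.ResidueAreaLaw.periodicBEC_of_correctorClosure hCC hK1

/-- So `closes` factors through W₁: the route decides the summit from (K1, W₁, BTW) and every proof of the
crux yields W₁. [folklore] -/
theorem closes_factors_through_weakClosure :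
    (CorrectorClosure → WeakClosure) ∧
      (StaticResponseBound → WeakClosure → BoundaryTransferWeak → _root_.BoseEinsteinCondensation) :=
  ⟨weakClosure_of_correctorClosure, summit_of_weakClosure⟩

/-! ## §2 Strengthen: the sector floor S⁺ feeds the BEC half with K1 idle -/

/-- **S⁺ ⇒ the torus-BEC half, bounded potentials, unconditionally in the tree**: the bodies of
`EnergyConvexityWindow` (item 9094) and `LandauSectorBound` (item 9091) give `PeriodicBECBody v` for every
BOUNDED admissible `v` (`landauToPeriodicBEC_bounded`: linear particle–hole floor → Wagner–Feynman infrared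
bound → mode counting). K1 does not occur. [folklore] -/
theorem periodicBECBody_bounded_of_strengthen (hE : EnergyConvexityWindow) (hL : LandauSectorBound)
    (v : ℝ → ℝ≥0∞) (hv : IsRepulsiveFiniteRange v) (hM : ∃ M : ℝ≥0∞, M ≠ ⊤ ∧ ∀ r, v r ≤ M) :
    PeriodicBECBody v :=
  Theorems.LandauToPeriodicBEC.landauToPeriodicBEC_bounded v hv hM (hE v hv) (hL v hv)

/-- **S⁺-line for the crux, bounded potentials**: S⁺ and the BEC-conditional residue (child 2 of §3) give the
crux restricted to bounded `v` — every hypothesis is an item of ANOTHER route or the split's child 2; this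
is the typed form of "the added rigidity buys the BEC half by landed theorems and nothing for the
route-specific half". [folklore] -/
theorem correctorClosure_bounded_of_strengthen (hE : EnergyConvexityWindow) (hL : LandauSectorBound)
    (hChild₂ : StaticResponseBound → ∀ v : ℝ → ℝ≥0∞, IsRepulsiveFiniteRange v →
      PeriodicBECBody v → InsertionResidueBody v)
    (hK1 : StaticResponseBound) (v : ℝ → ℝ≥0∞) (hv : IsRepulsiveFiniteRange v)
    (hM : ∃ M : ℝ≥0∞, M ≠ ⊤ ∧ ∀ r, v r ≤ M) : InsertionResidueBody v :=
  hChild₂ hK1 v hv (periodicBECBody_bounded_of_strengthen hE hL v hv hM)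

/-! ## §3 Decomposition: the exact split (landed, p169803), re-exported by name -/

/-- **CC ↔ child 1 ∧ child 2 given K1** (`correctorClosure_iff_of_staticResponseBound`): child 1 =
`∀ v, PeriodicBECBody v` = item 8997 verbatim; child 2 = `InsertionResidueOfBEC`. [folklore] -/
theorem split_exact (hK1 : StaticResponseBound) :
    CorrectorClosure ↔
      ((∀ v : ℝ → ℝ≥0∞, IsRepulsiveFiniteRange v → PeriodicBECBody v) ∧
        (StaticResponseBound → ∀ v : ℝ → ℝ≥0∞, IsRepulsiveFiniteRange v →
          PeriodicBECBody v → InsertionResidueBody v)) :=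
  Theorems.CorrectorClosure.Split.correctorClosure_iff_of_staticResponseBound hK1

/-- The assembly of the split, by name (`CorrectorClosure_of_subs`). [folklore] -/
theorem correctorClosure_of_split
    (hP : ∀ v : ℝ → ℝ≥0∞, IsRepulsiveFiniteRange v → PeriodicBECBody v)
    (hB : StaticResponseBound → ∀ v : ℝ → ℝ≥0∞, IsRepulsiveFiniteRange v →
      PeriodicBECBody v → InsertionResidueBody v) :
    CorrectorClosure :=
  Theorems.CorrectorClosure.Split.CorrectorClosure_of_subs hP hB

/-! ## §4 Transfer: the half that transfers from the reflection-positivity siblings is landed -/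

/-- **Infrared bound ⇒ torus BEC, per potential** (`periodicBEC_of_irBoundFor`, mode counting with the LSSY
energy upper bound): the step of KLS 1988 / ALSSY 2004 that survives the passage lattice → continuum. The
infrared bound `IRBoundFor v` itself (there: Gaussian domination from reflection positivity) is item 3972 /
12620 and does not mention K1. [folklore] -/
theorem transfer_half (v : ℝ → ℝ≥0∞) (hv : IsRepulsiveFiniteRange v) (hIR : IRBoundFor v) :
    PeriodicBECBody v :=
  Theorems.LandauToPeriodicBEC.periodicBEC_of_irBoundFor v hv hIR

/-- Hence a transfer line for W₁ would read `(∀ v, IRBoundFor v) → WeakClosure` with K1 unused — the typed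
form of "the transferred argument never touches the crux's hypothesis". [folklore] -/
theorem weakClosure_of_irBound (hIR : ∀ v : ℝ → ℝ≥0∞, IsRepulsiveFiniteRange v → IRBoundFor v) :
    WeakClosure :=
  fun _ v hv => transfer_half v hv (hIR v hv)

/-! ## §5 Negation -/

/-- **What a refutation must do**: `¬CC ↔ K1 ∧ ¬InsertionResidue` — prove K1 for EVERY admissible `v`
(item 12057, open) and refute the residue floor for one. [folklore] -/
theorem not_correctorClosure_iff : ¬ CorrectorClosure ↔ (StaticResponseBound ∧ ¬ InsertionResidue) := by
  unfold CorrectorClosure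
  exact Classical.not_imp

/-- **A "Bose metal" refutes the crux**: K1 together with ONE admissible potential whose torus
near-minimisers do not condense gives `¬CC` (contrapositive of §1). No such `v` is known in `d = 3`; in
`d = 1` every `v` is one (Disproof §13). [folklore] -/
theorem not_correctorClosure_of_nonCondensing (hK1 : StaticResponseBound) (v : ℝ → ℝ≥0∞)
    (hv : IsRepulsiveFiniteRange v) (hnb : ¬ PeriodicBECBody v) : ¬ CorrectorClosure :=
  fun hCC => hnb (weakClosure_of_correctorClosure hCC hK1 v hv)

end Summit.AtomisticToContinuum.BoseEinsteinCondensation.Cruxes.CorrectorClosure.CensusS10
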